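import Summits.CriticalPhenomena.PercolationContinuityZ3.Theorems.Transplant.SkelPhiKitsAStepIV
import HarnessLib

/-!
# N2 (frames-only node), (S0) kit tier, Skel side part 1a: **THE COLUMN OF A CONTACT** — the unit-step `φ`-walk from the stem end `t₁` along the exit
# side form's climbing axis to the kit centre's row (T4-S0 v1.1 §3: the forced set `E(stem) ∪ E(colPath) ∪ E(box)`; interface of record (R-16))

builds on p205010 (kernel theorem, internal audit signed; external expert review pending) — nothing in this file uses p205010; nothing here is a
claim about the open node `SamePDropOfSkeletonFrm₁`.
Lane `prim-bschramm`, seat `prim-bschramm-p1` (gen 16); helper file (`--supports stmt-CriticalPhenomena-4575 --as helper`).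
For a contact `x` of the window level (window map `ψ`, base chart `φ` with unit steps, exit side form `F = SF i₀ σ₀` as in N1's `SkelPhiApronKitDefs`):
`ctCol x` = the vertices `p₀ = t₁, …, p_K` of the straight walk `walk G φ F.a F.s t₁` with `K = F.kitK (φ t₁) D A` (`walk`, `φ_walk`, `walk_adj`:
`SkelPhiSeedSlab` §1); `ctColEnd x = p_K` lies over the kit centre's planar point `F.kitPt (φ t₁) D A = φ (ctCtr x)` (N1's centre `ctCtr x = colPt …` is a
CHOICE over that point; the two need not coincide).  Facts: the column is `G`-connected from `t₁` inside itself, lies in `B_G(t₁, KCmax)`, has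
`≤ KCmax + 1` vertices, and — for a NEAR contact — lies in the level window (the form increases along the walk, so the depth stays `≥ 1 + d`).
* `ctCol`, `ctColEnd`, `φ_walk_lin`, `φ_ctColEnd`, `ctT1_mem_ctCol`, `ctColEnd_mem_ctCol`, `pathIn_ctCol`, `kitK_ctT1_le`, `ctCol_subset_graphBall`,
  `card_ctCol_le`, `mem_winLevel_of_mem_ctCol`.
[cite: KozmaNitzan2024, §4 Lemma 10, p. 26 ((29): columns)] [cite: GrimmettPercolation1999, §7.2]
-/

noncomputable section

open scoped Classical

namespace Summit.CriticalPhenomena.PercolationContinuityZ3.Theorems.Transplant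

namespace Skelφ

open Literature.Probability.Percolation Literature.Probability.LatticeModels SimpleGraph KNLevels
open Literature.Probability.Percolation.KozmaNitzan.Cells (oth oth_ne eq_oth_of_ne oth_oth)
open Literature.Barriers.CriticalPhenomena (graphBall graphBall_finite mem_graphBall_self graphBall_mono)
open Skel (winGraph winGraph_adj KitGeom)
open SkelI (tanOff tanTgt tanTgt_mem)

variable {V : Type} [DecidableEq V] {G : SimpleGraph V} [G.LocallyFinite] {ψ φ : V → Site 2}

/-! ## §1 The column of a contact -/

section Column

variable (G) {Lo Hi : Site 2} (SF : ∀ (i : Fin 2) (σ : ℤˣ), SideForm ψ φ Lo Hi i σ) (P : ApronPrm) (w₀ : V) (R : ℕ)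

/-- **The column** of a contact `x`: the straight `φ`-walk from the stem end `t₁` along the climbing axis of the exit side form, `K = kitK (φ t₁) D A`
steps (vertices `p₀ = t₁, …, p_K`). [cite: KozmaNitzan2024, §4 p. 26 ((29): columns)] -/
def ctCol (x : V) : Finset V :=
  (Finset.range ((SF (ctDir G ψ w₀ R Lo Hi x).1 (ctDir G ψ w₀ R Lo Hi x).2).kitK (φ (ctT1 G ψ P w₀ R Lo Hi x)) (shellD P) P.A + 1)).image
    fun k => walk G φ (SF (ctDir G ψ w₀ R Lo Hi x).1 (ctDir G ψ w₀ R Lo Hi x).2).a (SF (ctDir G ψ w₀ R Lo Hi x).1 (ctDir G ψ w₀ R Lo Hi x).2).s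
      (ctT1 G ψ P w₀ R Lo Hi x) k

/-- **The column's end**: the walk vertex over the kit centre's planar point. [folklore] -/
def ctColEnd (x : V) : V :=
  walk G φ (SF (ctDir G ψ w₀ R Lo Hi x).1 (ctDir G ψ w₀ R Lo Hi x).2).a (SF (ctDir G ψ w₀ R Lo Hi x).1 (ctDir G ψ w₀ R Lo Hi x).2).s
    (ctT1 G ψ P w₀ R Lo Hi x) ((SF (ctDir G ψ w₀ R Lo Hi x).1 (ctDir G ψ w₀ R Lo Hi x).2).kitK (φ (ctT1 G ψ P w₀ R Lo Hi x)) (shellD P) P.A)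

variable {G SF P w₀ R}

omit [DecidableEq V] [G.LocallyFinite] in
/-- The side form along a straight walk on its climbing axis: `L(φ p_k) = L(φ v) + k·(s c_a)`. [folklore] -/
theorem φ_walk_lin (hstep : Steps G φ) {i₀ : Fin 2} {σ₀ : ℤˣ} (F : SideForm ψ φ Lo Hi i₀ σ₀) (v : V) (k : ℕ) :
    F.lin (φ (walk G φ F.a F.s v k)) = F.lin (φ v) + (k : ℤ) * ((F.s : ℤ) * coef F.cα F.cβ F.a) := by
  rw [φ_walk hstep]
  unfold SideForm.lin
  rw [linForm_add_single]; ring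

omit [DecidableEq V] [G.LocallyFinite] in
/-- **The column ends over the kit centre's planar point**: `φ (ctColEnd x) = kitPt (φ t₁) D A = φ (ctCtr x)`. [folklore] -/
theorem φ_ctColEnd (hstep : Steps G φ) (x : V) : φ (ctColEnd G SF P w₀ R x) = φ (ctCtr G SF P w₀ R x) := by
  rw [φ_ctCtr SF hstep]
  unfold ctColEnd SideForm.kitPt
  rw [φ_walk hstep]

omit [G.LocallyFinite] in
/-- The stem end is the column's first vertex. [folklore] -/
theorem ctT1_mem_ctCol (x : V) : ctT1 G ψ P w₀ R Lo Hi x ∈ ctCol G SF P w₀ R x := by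
  unfold ctCol
  exact Finset.mem_image.2 ⟨0, Finset.mem_range.2 (Nat.succ_pos _), rfl⟩

omit [G.LocallyFinite] in
/-- The column's end belongs to the column. [folklore] -/
theorem ctColEnd_mem_ctCol (x : V) : ctColEnd G SF P w₀ R x ∈ ctCol G SF P w₀ R x := by
  unfold ctCol ctColEnd
  exact Finset.mem_image.2 ⟨_, Finset.mem_range.2 (Nat.lt_succ_self _), rfl⟩

omit [G.LocallyFinite] in
/-- **The column is `G`-connected from the stem end inside itself** (under `Steps`). [folklore] -/
theorem pathIn_ctCol (hstep : Steps G φ) (x : V) : ∀ v ∈ ctCol G SF P w₀ R x, PathIn G (↑(ctCol G SF P w₀ R x) : Set V) (ctT1 G ψ P w₀ R Lo Hi x) v := by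
  intro v hv
  unfold ctCol at hv ⊢
  set F := SF (ctDir G ψ w₀ R Lo Hi x).1 (ctDir G ψ w₀ R Lo Hi x).2 with hF
  set t₁ := ctT1 G ψ P w₀ R Lo Hi x with ht₁
  set K := F.kitK (φ t₁) (shellD P) P.A with hK
  obtain ⟨k, hk, rfl⟩ := Finset.mem_image.1 hv
  have hk' : k ≤ K := Nat.lt_succ_iff.1 (Finset.mem_range.1 hk)
  have hmem : ∀ m ≤ K, walk G φ F.a F.s t₁ m ∈ (↑((Finset.range (K + 1)).image fun k => walk G φ F.a F.s t₁ k) : Set V) := fun m hm =>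
    Finset.mem_coe.2 (Finset.mem_image.2 ⟨m, Finset.mem_range.2 (Nat.lt_succ_iff.2 hm), rfl⟩)
  clear hk hv
  induction k with
  | zero => exact PathIn.refl (hmem 0 (Nat.zero_le _))
  | succ k ih => exact (ih (by omega)).tail (walk_adj hstep F.a F.s t₁ k) (hmem (k + 1) hk')

/-- The column's row count is at most `KCmax` for a contact whose stem end sits between rows `1 + d` and `2 + d` (hypothesis `hKC`). [folklore] -/
theorem kitK_ctT1_le (hlip : Lip G ψ) (hq : QStepsN G ψ P.N) (hw2 : ∀ i, Lo i + 2 ≤ Hi i) {KCmax : ℕ}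
    (hKC : ∀ (i : Fin 2) (σ : ℤˣ) (z : Site 2), (SF i σ).θ (1 + P.d) ≤ (SF i σ).lin z → (SF i σ).lin z < (SF i σ).θ (2 + P.d) →
      (SF i σ).kitK z (shellD P) P.A ≤ KCmax)
    {x : V} (hx : x ∈ outerBoundary (winGraph G w₀ R) (Win G ψ w₀ (Finset.Icc Lo Hi) R)) :
    (SF (ctDir G ψ w₀ R Lo Hi x).1 (ctDir G ψ w₀ R Lo Hi x).2).kitK (φ (ctT1 G ψ P w₀ R Lo Hi x)) (shellD P) P.A ≤ KCmax := by
  have ht := ψ_ctT1 hlip hq hw2 hx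
  set F := SF (ctDir G ψ w₀ R Lo Hi x).1 (ctDir G ψ w₀ R Lo Hi x).2
  exact hKC _ _ _ (F.le_lin_of_le_sdepth (by rw [ht.1])) (F.lin_lt_of_sdepth_lt (by rw [ht.1]; omega))

/-- **The column lies in the graph ball of radius `KCmax` about the stem end.** [folklore] -/
theorem ctCol_subset_graphBall (hlip : Lip G ψ) (hq : QStepsN G ψ P.N) (hstep : Steps G φ) (hw2 : ∀ i, Lo i + 2 ≤ Hi i) {KCmax : ℕ}
    (hKC : ∀ (i : Fin 2) (σ : ℤˣ) (z : Site 2), (SF i σ).θ (1 + P.d) ≤ (SF i σ).lin z → (SF i σ).lin z < (SF i σ).θ (2 + P.d) →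
      (SF i σ).kitK z (shellD P) P.A ≤ KCmax)
    {x : V} (hx : x ∈ outerBoundary (winGraph G w₀ R) (Win G ψ w₀ (Finset.Icc Lo Hi) R)) :
    ∀ v ∈ ctCol G SF P w₀ R x, v ∈ graphBall G (ctT1 G ψ P w₀ R Lo Hi x) KCmax := by
  intro v hv
  unfold ctCol at hv
  obtain ⟨k, hk, rfl⟩ := Finset.mem_image.1 hv
  have hk' := Nat.lt_succ_iff.1 (Finset.mem_range.1 hk)
  exact graphBall_mono G _ (hk'.trans (kitK_ctT1_le hlip hq hw2 hKC hx)) (walk_mem_graphBall hstep _ _ _ k)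

/-- The column has at most `KCmax + 1` vertices. [folklore] -/
theorem card_ctCol_le (hlip : Lip G ψ) (hq : QStepsN G ψ P.N) (hw2 : ∀ i, Lo i + 2 ≤ Hi i) {KCmax : ℕ}
    (hKC : ∀ (i : Fin 2) (σ : ℤˣ) (z : Site 2), (SF i σ).θ (1 + P.d) ≤ (SF i σ).lin z → (SF i σ).lin z < (SF i σ).θ (2 + P.d) →
      (SF i σ).kitK z (shellD P) P.A ≤ KCmax)
    {x : V} (hx : x ∈ outerBoundary (winGraph G w₀ R) (Win G ψ w₀ (Finset.Icc Lo Hi) R)) :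
    (ctCol G SF P w₀ R x).card ≤ KCmax + 1 := by
  unfold ctCol
  refine Finset.card_image_le.trans ?_
  rw [Finset.card_range]
  exact Nat.succ_le_succ (kitK_ctT1_le hlip hq hw2 hKC hx)

/-- **The column of a near contact lies in the level window**: its vertices sit at depth `≥ 1 + d` (the side form increases along the walk) and
`≤ 1 + d + KCmax`, tangentially within `KCmax ≤ T₀` of the clamped target, and within `r₀` of the inner neighbour. [this work] -/
theorem mem_winLevel_of_mem_ctCol (hlip : Lip G ψ) (hq : QStepsN G ψ P.N) (hstep : Steps G φ) (hwide : ∀ i, Lo i + 2 * tanOff P.ℓs P.M ≤ Hi i)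
    {KCmax : ℕ}
    (hKC : ∀ (i : Fin 2) (σ : ℤˣ) (z : Site 2), (SF i σ).θ (1 + P.d) ≤ (SF i σ).lin z → (SF i σ).lin z < (SF i σ).θ (2 + P.d) →
      (SF i σ).kitK z (shellD P) P.A ≤ KCmax)
    (hr₀ : P.N * (tanOff P.ℓs P.M + 1) + P.N * P.d + KCmax ≤ P.r₀) (hR : P.r₀ ≤ R) (hT : (KCmax : ℤ) ≤ tanOff P.ℓs P.M)
    (hDw : ∀ i, Lo i + ((1 + P.d + KCmax : ℕ) : ℤ) ≤ Hi i)
    {x : V} (hx : x ∈ outerBoundary (winGraph G w₀ R) (Win G ψ w₀ (Finset.Icc Lo Hi) R)) (hnear : IsNear G ψ Lo Hi P w₀ R x) :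
    ∀ v ∈ ctCol G SF P w₀ R x, v ∈ Win G ψ w₀ (Finset.Icc Lo Hi) R := by
  intro v hv
  have hw2 : ∀ i, Lo i + 2 ≤ Hi i := fun i => by have := hwide i; unfold tanOff at this; omega
  have ht := ψ_ctT1 hlip hq hw2 hx
  set F := SF (ctDir G ψ w₀ R Lo Hi x).1 (ctDir G ψ w₀ R Lo Hi x).2 with hF
  set t₁ := ctT1 G ψ P w₀ R Lo Hi x with ht₁
  have hvt : v ∈ graphBall G t₁ KCmax := ctCol_subset_graphBall hlip hq hstep hw2 hKC hx v hv
  -- the form does not decrease along the column: depth `≥ 1 + d`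
  have hdepth : 1 + (P.d : ℤ) ≤ sdepth ψ Lo Hi (ctDir G ψ w₀ R Lo Hi x).1 (ctDir G ψ w₀ R Lo Hi x).2 v := by
    unfold ctCol at hv
    obtain ⟨k, -, rfl⟩ := Finset.mem_image.1 hv
    refine F.le_sdepth_of_lin ?_
    rw [φ_walk_lin hstep F t₁ k]
    have h0 : F.θ (1 + P.d) ≤ F.lin (φ t₁) := F.le_lin_of_le_sdepth (by rw [ht.1])
    have hC := F.clim_pos
    nlinarith
  rw [mem_Win]
  refine ⟨?_, ?_⟩
  · -- inside `B_G(w₀, R)`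
    have hvy : v ∈ graphBall G (ctY G ψ w₀ R Lo Hi x) (P.N * (tanOff P.ℓs P.M + 1) + P.N * P.d + KCmax) :=
      BoxProdZ2.mem_graphBall_add G (ctT1_mem_graphBall hq hwide hx) hvt
    have h := BoxProdZ2.mem_graphBall_add G hnear (graphBall_mono G _ hr₀ hvy)
    rwa [Nat.sub_add_cancel hR] at h
  · -- planar window coordinates in the box
    have hexit := sdepth_sub_le_of_mem_graphBall hlip (Lo := Lo) (Hi := Hi) (ctDir G ψ w₀ R Lo Hi x).1 (ctDir G ψ w₀ R Lo Hi x).2 hvt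
    rw [ht.1, abs_le] at hexit
    have htan := abs_sub_le_of_mem_graphBall hlip hvt (oth (ctDir G ψ w₀ R Lo Hi x).1)
    rw [ht.2, abs_le] at htan
    have hτ := tanTgt_mem (oth (ctDir G ψ w₀ R Lo Hi x).1) (hwide (oth _)) (ψ (ctY G ψ w₀ R Lo Hi x))
    have hwid := hDw (ctDir G ψ w₀ R Lo Hi x).1
    push_cast at hexit htan hwid
    rw [Finset.mem_Icc]
    constructor <;> intro i
    · by_cases hi : i = (ctDir G ψ w₀ R Lo Hi x).1
      · rw [hi]; unfold sdepth at hdepth hexit; split_ifs at hdepth hexit <;> linarith [hexit.1, hexit.2]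
      · rw [eq_oth_of_ne hi]; linarith [htan.1, hτ.1]
    · by_cases hi : i = (ctDir G ψ w₀ R Lo Hi x).1
      · rw [hi]; unfold sdepth at hdepth hexit; split_ifs at hdepth hexit <;> linarith [hexit.1, hexit.2]
      · rw [eq_oth_of_ne hi]; linarith [htan.2, hτ.2]

end Column

end Skelφ

end Summit.CriticalPhenomena.PercolationContinuityZ3.Theorems.Transplant

end
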